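import Mathlib.RingTheory.UniqueFactorizationDomain.Multiplicity
import Mathlib.RingTheory.Ideal.Colon
import Mathlib.RingTheory.TensorProduct.Finite
import Mathlib.RingTheory.Localization.FractionRing
import Literature.RingTheory.FittingIdeal.DiscreteValuationRing
import Literature.RingTheory.FittingIdeal.Localization
import Literature.RingTheory.FittingIdeal.Annihilator
import Literature.NumberTheory.EllipticCurves.IwasawaAlgebraDivisibilityProofs
import Literature.NumberTheory.EllipticCurves.IwasawaAlgebraStructureProofs
import HarnessLib

/-!
# Skinner–Urban 2014, §3.1.6 and Corollary 3.2.9: Fitting ideals, characteristic ideals, and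
# their behaviour under base change (the algebra of "descending a main conjecture")

C. Skinner, E. Urban, *The Iwasawa main conjectures for `GL₂`*, Invent. Math. 195 (2014), 1–277
(bib key `SkinnerUrban2014`; held author version `paper:doi-10-1007-s00222-013-0448-1`, whose
three-level numbering and pages are used in every `[cite:]` of the tree for this source).

**§3.1.6, as printed** (pp. 19–20 of the held text). "Fitting ideals behave well with respect to
base change. For any noetherian `A`-algebra `B`, `Fitt_B(X ⊗_A B) = Fitt_A(X)B`. In particular, if
`I ⊂ A` is an ideal, then `Fitt_{A/I}(X/IX) = Fitt_A(X) mod I`. … The characteristic ideal of an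
`A`-module `X` is the divisorial ideal `Char_A(X) := {x ∈ A : ord_Q(x) ≥ ℓ_Q(X) ∀ Q of height
one}`, where `ℓ_Q(X)` is the `A_Q`-length of the `Q`-localization `X_Q` … One checks easily that
`Char_A(A/Fitt_A(X)) = Char_A(X)`. Unlike Fitting ideals, characteristic ideals do not behave well
under base change in general. … In the cases of interest to us, for the purposes of base change we
are able to make do with a weaker statement (see Corollary 3.2.9)."

**Corollary 3.2.9, as printed** (p. 24, with the hypotheses of Prop. 3.2.8, under which
`X^Σ_F(T/𝔞T) ≅ X^Σ_F(T)/𝔞X^Σ_F(T)`): "(i) `Ft^Σ_{F,A/𝔞}(T/𝔞T) = Ft^Σ_{F,A}(T) mod 𝔞`;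
(ii) if `A` and `A/𝔞` are noetherian normal domains then `(f) mod 𝔞` divides `Ch^Σ_{F,A/𝔞}(T/𝔞)`
for any principal ideal `(f) ⊇ Ch^Σ_{F,A}`; in particular, if `A` is a unique factorization domain
then `Ch^Σ_{F,A}(T) mod 𝔞` divides `Ch^Σ_{F,A/𝔞}(T/𝔞)`. *Proof.* Part (i) follows from basic
properties of Fitting ideals (cf. 3.1.6), and part (ii) follows from the fact that the
characteristic ideal is the smallest divisorial ideal containing the Fitting ideal (and that
principal ideals are divisorial)." Here "`I` divides `J`" means `I ⊇ J` (§3.1.6 (i) ⟺ (ii)).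

This is the base-change statement through which Skinner–Urban descend the three-variable
divisibility to the cyclotomic line (Prop. 3.2.11: "`Ch^Σ_{K_∞}(T) mod I⁻` divides
`Ch^Σ_{K_∞^+}(T)`", proof "The claim about characteristic ideals then follows from part (ii) of
Corollary 3.2.9"; proof of Thm. 3.6.4, p. 43), and — with Lemma 3.1.7 (tree file
`SkinnerUrban2014/FittingIdealLemma.lean`) — the whole commutative algebra of §§3.1–3.2 of the
paper. This file PROVES it (theorems only; no definition, no named fact) for the tree's
characteristic ideal `Literature.NumberTheory.EllipticCurves.Module.charIdeal A X =
∏_{ht 𝔭 = 1} 𝔭 ^ length_{A_𝔭}(X_𝔭)` (`IwasawaAlgebra.lean`) and the tree's Fitting ideal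
`Literature.RingTheory.FittingIdeal.Module.fittingIdeal A X 0`, in the printed "in particular" /
unique-factorization generality (both `A` and the base-changed ring are Noetherian UFDs — the
case of `Λ = ℤ_p⟦T⟧ → ℤ_p`, `𝒪⟦T⟧ → 𝒪`, `ℤ_p⟦T₁,T₂⟧ → ℤ_p⟦T⟧`):

* §3.1.6 "`Char_A(A/Fitt_A(X)) = Char_A(X)`": `lengthAt_eq_lengthAt_quotient_fittingIdeal` (local
  form at a principal height-one prime of a Noetherian domain) and `charIdeal_quotient_fittingIdeal`.
* §3.1.6 "the characteristic ideal is the smallest divisorial ideal containing the Fitting ideal",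
  for PRINCIPAL ideals over a Noetherian UFD: `fittingIdeal_zero_le_charIdeal` (`Fitt₀(X) ⊆
  Char(X)`, no torsion hypothesis) and `charIdeal_le_span_singleton_of_fittingIdeal_zero_le`
  (`Fitt₀(X) ⊆ (g) ⇒ Char(X) ⊆ (g)` for `X` torsion); together `charIdeal_le_span_singleton_iff`.
* Cor. 3.2.9 (i): `fittingIdeal_quotient_baseChange` (= the tree's `Module.fittingIdeal_baseChange`
  at `B = A/𝔞`).
* Cor. 3.2.9 (ii): `charIdeal_baseChange_le_span_singleton` (any Noetherian UFD `A`-algebra `B`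
  with `X ⊗_A B` torsion: `Char_A(X) ⊆ (f) ⇒ Char_B(X ⊗_A B) ⊆ (f·1_B)`), the printed quotient
  form `corollary329_charIdeal_quotient_le_span_singleton`, and the printed "in particular"
  `corollary329_charIdeal_quotient_le_map_charIdeal` (`Ch_{A/𝔞}(X/𝔞X) ⊆ Ch_A(X) mod 𝔞`); for the
  Iwasawa algebra `Λ = ℤ_p⟦T⟧` (where `Ch_Λ` is principal, tree theorem
  `charIdeal_isPrincipal_holds`): `corollary329_iwasawaAlgebra`.

On the torsion hypothesis: the printed statement allows `ℓ_Q = ∞` (then `Char = 0` and (ii) is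
empty); the tree's `charIdeal` assigns exponent `0` to an infinite local length, so (ii) is stated
here for `X ⊗_A B` a TORSION `B`-module — exactly the situation of Prop. 3.2.8 / 3.2.11 / Thm.
3.6.4, where the dual Selmer groups are torsion (Thm. 3.3.7, Kato). The printed general form —
`A`, `A/𝔞` Noetherian NORMAL domains (divisorial ideals) — is PROVED in the sibling file
`SkinnerUrban2014/CharacteristicIdealBaseChangeNormalProofs.lean` (2026-08-21), by Krull's
`A = ⋂_{ht Q = 1} A_Q` (Matsumura Thm. 11.5), which the tree has as
`Literature.RingTheory.IntegralClosure.mem_span_singleton_of_forall_height_eq_one`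
(`Literature/RingTheory/IntegralClosure/KrullIntersection.lean`).

Sources of the proofs: Skinner–Urban §3.1.6 and Cor. 3.2.9 [SkinnerUrban2014]; B. de Smit,
K. Rubin, R. Schoof, *Criteria for complete intersections* (1997) §1 (`Fit_A(M) = 𝔪^{length M}`
over a discrete valuation ring; tree `Module.fittingIdeal_zero_eq_maximalIdeal_pow`)
[DeSmitRubinSchoof1997]; The Stacks Project, Tags 07ZA (base change of Fitting ideals; tree
`Module.fittingIdeal_baseChange`, `Module.fittingIdeal_of_isLocalizedModule`) and 07ZC
[StacksProject]; Bourbaki AC VII §4 / Washington §13.2 for `Char` [Washington1997]. The generic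
height-one bookkeeping (`finite_heightOne_inter_mulSupport`, `lengthAt_ne_top_of_isTorsionBy`,
`isPrincipalIdealRing_localization_of_eq_span`, `height_span_singleton_eq_one_of_prime`) is the
tree's (`IwasawaAlgebra*Proofs.lean`). (The cell's X11b files `Summits/…/X11b/Fitting*.lean` prove
cognate statements over `Summits/`, which a `Literature/` file may not import.)
-/

noncomputable section

open scoped TensorProduct

open Literature.RingTheory.FittingIdeal Literature.NumberTheory.EllipticCurves
  Literature.NumberTheory.EllipticCurves.Module

namespace Literature.NumberTheory.EllipticCurves.SkinnerUrban2014

universe u v w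

variable {R : Type u} [CommRing R]

/-! ### `Fitt₀ ≠ 0` for torsion modules -/

/-- **`Fitt_A(X) ≠ 0` for a finitely generated torsion module over a domain** (Stacks 07ZC at the
generic point: `Fitt_K(X ⊗ K) = Fitt_A(X) K` and `X ⊗_A K = 0`, so `Fitt_A(X) K = K`).
[cite: StacksProject, Tag 07ZC] -/
theorem fittingIdeal_zero_ne_bot_of_isTorsion [IsDomain R] {M : Type v} [AddCommGroup M]
    [Module R M] [Module.Finite R M] (hM : Module.IsTorsion R M) :
    Module.fittingIdeal R M 0 ≠ ⊥ := by
  intro hbot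
  set K := FractionRing R
  set S := nonZeroDivisors R
  -- `M ⊗ K = M_S = 0`
  haveI : Subsingleton (LocalizedModule S M) := by
    refine LocalizedModule.subsingleton_iff.mpr fun m => ?_
    obtain ⟨⟨s, hs⟩, hsm⟩ := @hM m
    exact ⟨s, hs, hsm⟩
  -- hence its Fitting ideal is the unit ideal
  have htop : Module.fittingIdeal K (LocalizedModule S M) 0 = ⊤ :=
    Module.fittingIdeal_eq_top_of_span_eq_top (R := K) (M := LocalizedModule S M)
      (k := 0) (fun i => Fin.elim0 i) (by
        rw [eq_top_iff]
        rintro x -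
        rw [Subsingleton.elim x 0]
        exact Submodule.zero_mem _)
  -- but it is also the extension of `Fitt₀(M) = 0`
  have hloc := Module.fittingIdeal_of_isLocalizedModule S K (LocalizedModule.mkLinearMap S M) 0
  rw [htop, hbot, Ideal.map_bot] at hloc
  exact top_ne_bot hloc

/-! ### §3.1.6: `Char_A(A/Fitt_A(X)) = Char_A(X)` -/

section Local

variable [IsNoetherianRing R] [IsDomain R] {M : Type v} [AddCommGroup M] [Module R M]
  [Module.Finite R M]

/-- **§3.1.6, local form: `ℓ_Q(X) = ℓ_Q(A/Fitt_A(X))`** at a nonzero principal prime `Q = (g)` of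
a Noetherian domain `A` (so `A_Q` is a discrete valuation ring): Fitting ideals localise
(Stacks 07ZA (3)), and over a discrete valuation ring the length of a finite module is the colength
of its Fitting ideal (de Smit–Rubin–Schoof §1), while `Fitt_A(A/Fitt_A(X)) = Fitt_A(X)`.
[cite: SkinnerUrban2014, §3.1.6 (p. 20)] [cite: DeSmitRubinSchoof1997, §1, p. 347] -/
theorem lengthAt_eq_lengthAt_quotient_fittingIdeal (𝔭 : PrimeSpectrum R) {g : R}
    (hg𝔭 : 𝔭.asIdeal = Ideal.span {g}) (hg : g ≠ 0) :
    lengthAt R M 𝔭 = lengthAt R (R ⧸ Module.fittingIdeal R M 0) 𝔭 := by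
  obtain ⟨hPID, hmax, hirr⟩ := isPrincipalIdealRing_localization_of_eq_span 𝔭.asIdeal hg𝔭 hg
  haveI : IsPrincipalIdealRing (Localization.AtPrime 𝔭.asIdeal) := hPID
  haveI : IsDiscreteValuationRing (Localization.AtPrime 𝔭.asIdeal) :=
    { not_a_field' := by
        rw [hmax, Ne, Ideal.span_singleton_eq_bot]
        exact hirr.ne_zero }
  -- `Fitt_A(A/I) = I` (Stacks 07ZA (4)) for `I = Fitt_A(X)`: `⊇` is the tree's
  -- `Module.mem_fittingIdeal_zero_quotient`, `⊆` is `Fitt₀ ⊆ Ann` and `Ann_A(A/I) = I`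
  have hquot : Module.fittingIdeal R (R ⧸ Module.fittingIdeal R M 0) 0 =
      Module.fittingIdeal R M 0 := by
    refine le_antisymm ?_ fun i hi => Module.mem_fittingIdeal_zero_quotient _ hi
    calc Module.fittingIdeal R (R ⧸ Module.fittingIdeal R M 0) 0
        ≤ Module.annihilator R (R ⧸ Module.fittingIdeal R M 0) :=
          Module.fittingIdeal_zero_le_annihilator
      _ = Module.fittingIdeal R M 0 := Ideal.annihilator_quotient
  have hF : Module.fittingIdeal (Localization.AtPrime 𝔭.asIdeal)
        (LocalizedModule 𝔭.asIdeal.primeCompl M) 0 =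
      Module.fittingIdeal (Localization.AtPrime 𝔭.asIdeal)
        (LocalizedModule 𝔭.asIdeal.primeCompl (R ⧸ Module.fittingIdeal R M 0)) 0 := by
    rw [Module.fittingIdeal_of_isLocalizedModule 𝔭.asIdeal.primeCompl
        (Localization.AtPrime 𝔭.asIdeal) (LocalizedModule.mkLinearMap 𝔭.asIdeal.primeCompl M) 0,
      Module.fittingIdeal_of_isLocalizedModule 𝔭.asIdeal.primeCompl
        (Localization.AtPrime 𝔭.asIdeal)
        (LocalizedModule.mkLinearMap 𝔭.asIdeal.primeCompl (R ⧸ Module.fittingIdeal R M 0)) 0,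
      hquot]
  unfold lengthAt
  rw [← Module.length_quotient_fittingIdeal_zero (O := Localization.AtPrime 𝔭.asIdeal)
      (N := LocalizedModule 𝔭.asIdeal.primeCompl M),
    ← Module.length_quotient_fittingIdeal_zero (O := Localization.AtPrime 𝔭.asIdeal)
      (N := LocalizedModule 𝔭.asIdeal.primeCompl (R ⧸ Module.fittingIdeal R M 0)), hF]

/-- **§3.1.6: "One checks easily that `Char_A(A/Fitt_A(X)) = Char_A(X)`"**, over a Noetherian
unique factorization domain (every height-one prime is principal and nonzero, so the local lengths
agree prime by prime by `lengthAt_eq_lengthAt_quotient_fittingIdeal`).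
[cite: SkinnerUrban2014, §3.1.6 (p. 20)] -/
theorem charIdeal_quotient_fittingIdeal [UniqueFactorizationMonoid R] :
    charIdeal R (R ⧸ Module.fittingIdeal R M 0) = charIdeal R M := by
  unfold charIdeal
  refine finprod_mem_congr rfl fun 𝔭 h𝔭 => ?_
  have h1 : 𝔭.asIdeal.height = 1 := h𝔭
  obtain ⟨g, hg⟩ := UniqueFactorizationMonoid.isPrincipal_of_height_eq_one h1
  have hg' : 𝔭.asIdeal = Ideal.span {g} := by rw [hg, Ideal.submodule_span_eq]
  have hg0 : g ≠ 0 := by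
    rintro rfl
    exact Ideal.ne_bot_of_height_eq_one h1 (by rw [hg', Ideal.span_singleton_eq_bot])
  rw [← lengthAt_eq_lengthAt_quotient_fittingIdeal (M := M) 𝔭 hg' hg0]

/-! ### §3.1.6: the characteristic ideal is the smallest principal ideal containing the Fitting
ideal (Noetherian UFD) -/

/-- Local lower bound: if `Fitt_A(X) ⊆ (g)` and `ρ^k ∣ g` for a prime element `ρ`, then
`k ≤ ℓ_{(ρ)}(X)` for a finite torsion module `X` over a Noetherian domain (`A_{(ρ)}` is a discrete
valuation ring with uniformizer `ρ`, `Fitt(X_{(ρ)}) = (ρ)^{ℓ} ⊆ (g) ⊆ (ρ)^k`).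
[cite: SkinnerUrban2014, §3.1.6 (p. 20)] [cite: DeSmitRubinSchoof1997, §1, p. 347] -/
theorem natCast_le_lengthAt_of_fittingIdeal_zero_le_of_pow_dvd (hM : Module.IsTorsion R M)
    {g ρ : R} (hρ : Prime ρ) {k : ℕ} (hk : ρ ^ k ∣ g)
    (hFg : Module.fittingIdeal R M 0 ≤ Ideal.span {g})
    (𝔭 : PrimeSpectrum R) (h𝔭 : 𝔭.asIdeal = Ideal.span {ρ}) :
    (k : ℕ∞) ≤ lengthAt R M 𝔭 := by
  obtain ⟨hPID, hmax, hirr⟩ := isPrincipalIdealRing_localization_of_eq_span 𝔭.asIdeal h𝔭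
    hρ.ne_zero
  set Rp := Localization.AtPrime 𝔭.asIdeal
  haveI : IsPrincipalIdealRing Rp := hPID
  haveI : IsDiscreteValuationRing Rp :=
    { not_a_field' := by
        rw [hmax, Ne, Ideal.span_singleton_eq_bot]
        exact hirr.ne_zero }
  -- the local length is finite: `M` is killed by some `s ≠ 0` and `ht 𝔭 = 1`
  obtain ⟨s, hsann, hs0⟩ := Submodule.annihilator_top_inter_nonZeroDivisors hM
  have hs : s ≠ 0 := nonZeroDivisors.ne_zero hs0
  have hsX : Module.IsTorsionBy R M s := fun x =>
    Submodule.mem_annihilator.mp hsann x Submodule.mem_top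
  have h1 : 𝔭.asIdeal.height = 1 := by
    rw [h𝔭]; exact height_span_singleton_eq_one_of_prime hρ
  obtain ⟨n, hn⟩ := ENat.ne_top_iff_exists.mp (lengthAt_ne_top_of_isTorsionBy hs hsX 𝔭 h1.le)
  rw [← hn, Nat.cast_le]
  -- `Fitt₀(M_𝔭) = 𝔪^n = (ρ^n)` and `Fitt₀(M_𝔭) = Fitt₀(M) R_𝔭 ⊆ (g) ⊆ (ρ^k)`
  have hlen : Module.length Rp (LocalizedModule 𝔭.asIdeal.primeCompl M) = n := hn.symm
  have hFit := Module.fittingIdeal_zero_eq_maximalIdeal_pow (O := Rp)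
    (N := LocalizedModule 𝔭.asIdeal.primeCompl M) hlen
  rw [Module.fittingIdeal_of_isLocalizedModule 𝔭.asIdeal.primeCompl Rp
      (LocalizedModule.mkLinearMap 𝔭.asIdeal.primeCompl M) 0, hmax, Ideal.span_singleton_pow,
    ← map_pow] at hFit
  have hle : Ideal.span {algebraMap R Rp (ρ ^ n)} ≤ Ideal.span {algebraMap R Rp (ρ ^ k)} := by
    rw [← hFit]
    refine (Ideal.map_mono hFg).trans ?_
    rw [Ideal.map_span, Set.image_singleton, Ideal.span_singleton_le_span_singleton]
    exact map_dvd (algebraMap R Rp) hk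
  rw [Ideal.span_singleton_le_span_singleton, map_pow, map_pow] at hle
  exact (pow_dvd_pow_iff hirr.ne_zero hirr.not_isUnit).mp hle

/-- Local upper bound (the companion of the previous lemma): for `x ∈ Fitt_A(X)` and a prime
element `ρ`, `ρ^{ℓ_{(ρ)}(X)} ∣ x` for a finite torsion module `X` over a Noetherian domain
(`x/1 ∈ Fitt(X_{(ρ)}) = (ρ)^{ℓ}` in the discrete valuation ring `A_{(ρ)}`, then clear the
denominator, which is prime to `ρ`). [cite: SkinnerUrban2014, §3.1.6 (p. 20)]
[cite: DeSmitRubinSchoof1997, §1, p. 347] -/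
theorem pow_toNat_lengthAt_dvd_of_mem_fittingIdeal_zero (hM : Module.IsTorsion R M)
    {ρ : R} (hρ : Prime ρ) (𝔭 : PrimeSpectrum R) (h𝔭 : 𝔭.asIdeal = Ideal.span {ρ})
    {x : R} (hx : x ∈ Module.fittingIdeal R M 0) :
    ρ ^ (lengthAt R M 𝔭).toNat ∣ x := by
  obtain ⟨hPID, hmax, hirr⟩ := isPrincipalIdealRing_localization_of_eq_span 𝔭.asIdeal h𝔭
    hρ.ne_zero
  set Rp := Localization.AtPrime 𝔭.asIdeal
  haveI : IsPrincipalIdealRing Rp := hPID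
  haveI : IsDiscreteValuationRing Rp :=
    { not_a_field' := by
        rw [hmax, Ne, Ideal.span_singleton_eq_bot]
        exact hirr.ne_zero }
  obtain ⟨s, hsann, hs0⟩ := Submodule.annihilator_top_inter_nonZeroDivisors hM
  have hs : s ≠ 0 := nonZeroDivisors.ne_zero hs0
  have hsX : Module.IsTorsionBy R M s := fun x =>
    Submodule.mem_annihilator.mp hsann x Submodule.mem_top
  have h1 : 𝔭.asIdeal.height = 1 := by
    rw [h𝔭]; exact height_span_singleton_eq_one_of_prime hρ
  obtain ⟨n, hn⟩ := ENat.ne_top_iff_exists.mp (lengthAt_ne_top_of_isTorsionBy hs hsX 𝔭 h1.le)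
  rw [← hn, ENat.toNat_coe]
  have hlen : Module.length Rp (LocalizedModule 𝔭.asIdeal.primeCompl M) = n := hn.symm
  -- `x/1 ∈ Fitt₀(M_𝔭) = (ρ/1)^n`
  have hxmem : algebraMap R Rp x ∈
      Module.fittingIdeal Rp (LocalizedModule 𝔭.asIdeal.primeCompl M) 0 := by
    rw [Module.fittingIdeal_of_isLocalizedModule 𝔭.asIdeal.primeCompl Rp
      (LocalizedModule.mkLinearMap 𝔭.asIdeal.primeCompl M) 0]
    exact Ideal.mem_map_of_mem _ hx
  rw [Module.fittingIdeal_zero_eq_maximalIdeal_pow hlen, hmax, Ideal.span_singleton_pow,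
    ← map_pow, Ideal.mem_span_singleton] at hxmem
  obtain ⟨y, hy⟩ := hxmem
  obtain ⟨⟨a, t⟩, rfl⟩ := IsLocalization.mk'_surjective 𝔭.asIdeal.primeCompl y
  -- clear denominators: `x * t = ρ^n * a` in `R`
  have h1' : algebraMap R Rp (x * t) = algebraMap R Rp (ρ ^ n * a) := by
    rw [map_mul, map_mul, hy, mul_assoc, IsLocalization.mk'_spec]
  obtain ⟨c, hc⟩ := (IsLocalization.eq_iff_exists 𝔭.asIdeal.primeCompl _).mp h1'
  have hc0 : (c : R) ≠ 0 := by
    intro h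
    exact c.2 (show (c : R) ∈ 𝔭.asIdeal from h ▸ 𝔭.asIdeal.zero_mem)
  have h2 : x * t = ρ ^ n * a := mul_left_cancel₀ hc0 hc
  have ht : ¬ ρ ∣ (t : R) := by
    intro h
    have hmem : (t : R) ∈ Ideal.span {ρ} := Ideal.mem_span_singleton.mpr h
    exact t.2 (le_of_eq h𝔭.symm hmem)
  exact hρ.pow_dvd_of_dvd_mul_right n ht (h2 ▸ dvd_mul_right (ρ ^ n) a)

end Local

section UFD

variable [IsNoetherianRing R] [IsDomain R] [UniqueFactorizationMonoid R]
  {M : Type v} [AddCommGroup M] [Module R M] [Module.Finite R M]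

/-- The characteristic ideal of a finite torsion module over a Noetherian UFD, written as a
principal ideal: `Char(X) = (∏_{𝔭 ∈ t} π_𝔭 ^ ℓ_𝔭(X))` over the finite set `t` of height-one primes
`𝔭 = (π_𝔭)` carrying `X`, with pairwise non-associated prime elements `π_𝔭`
(Washington §13.2; the finiteness and principality bookkeeping of the tree's
`exists_pow_mul_mem_charIdeal_of_lengthAt_le`). [cite: Washington1997, §13.2] -/
theorem exists_charIdeal_eq_span_prod (hM : Module.IsTorsion R M) :
    ∃ (t : Finset (PrimeSpectrum R)) (π : PrimeSpectrum R → R),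
      (∀ 𝔭 ∈ t, 𝔭.asIdeal.height = 1 ∧ Prime (π 𝔭) ∧ 𝔭.asIdeal = Ideal.span {π 𝔭}) ∧
      (∀ 𝔭 : PrimeSpectrum R, 𝔭.asIdeal.height = 1 → lengthAt R M 𝔭 ≠ ⊤) ∧
      (∀ 𝔭 : PrimeSpectrum R, 𝔭.asIdeal.height = 1 → lengthAt R M 𝔭 ≠ 0 → 𝔭 ∈ t) ∧
      charIdeal R M = Ideal.span {∏ 𝔭 ∈ t, π 𝔭 ^ (lengthAt R M 𝔭).toNat} := by
  classical
  obtain ⟨s, hsann, hs0⟩ := Submodule.annihilator_top_inter_nonZeroDivisors hM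
  have hs : s ≠ 0 := nonZeroDivisors.ne_zero hs0
  have hsX : Module.IsTorsionBy R M s := fun x =>
    Submodule.mem_annihilator.mp hsann x Submodule.mem_top
  set F : PrimeSpectrum R → Ideal R := fun 𝔭 => 𝔭.asIdeal ^ (lengthAt R M 𝔭).toNat with hF
  have hfin := finite_heightOne_inter_mulSupport hs hsX
  set t : Finset (PrimeSpectrum R) := hfin.toFinset with ht
  have hchar : charIdeal R M = ∏ 𝔭 ∈ t, F 𝔭 := by
    unfold charIdeal
    refine finprod_mem_eq_prod_of_inter_mulSupport_eq F ?_
    rw [ht, Set.Finite.coe_toFinset, Set.inter_assoc, Set.inter_self]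
  have hmem : ∀ 𝔭 ∈ t, 𝔭.asIdeal.height = 1 ∧ s ∈ 𝔭.asIdeal := by
    intro 𝔭 h𝔭
    rw [ht, Set.Finite.mem_toFinset] at h𝔭
    refine ⟨h𝔭.1, ?_⟩
    by_contra hns
    exact h𝔭.2 (by simp [lengthAt_eq_zero_of_isTorsionBy hsX 𝔭 hns])
  have hgen : ∀ 𝔭 ∈ t, ∃ π : R, Prime π ∧ 𝔭.asIdeal = Ideal.span {π} := by
    intro 𝔭 h𝔭
    obtain ⟨h1, hs𝔭⟩ := hmem 𝔭 h𝔭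
    have hne : 𝔭.asIdeal ≠ ⊥ := fun hbot => hs (by rwa [hbot, Ideal.mem_bot] at hs𝔭)
    obtain ⟨π, hπ𝔭, hπ⟩ := Ideal.IsPrime.exists_mem_prime_of_ne_bot 𝔭.isPrime hne
    exact ⟨π, hπ, Ideal.eq_span_singleton_of_height_eq_one h1 hπ𝔭 hπ⟩
  choose! π hπ hπeq using hgen
  refine ⟨t, π, fun 𝔭 h𝔭 => ⟨(hmem 𝔭 h𝔭).1, hπ 𝔭 h𝔭, hπeq 𝔭 h𝔭⟩,
    fun 𝔭 h1 => lengthAt_ne_top_of_isTorsionBy hs hsX 𝔭 (le_of_eq h1), ?_, ?_⟩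
  · intro 𝔭 h1 hne
    rw [ht, Set.Finite.mem_toFinset]
    refine ⟨h1, ?_⟩
    have hfinlen : lengthAt R M 𝔭 ≠ ⊤ := lengthAt_ne_top_of_isTorsionBy hs hsX 𝔭 (le_of_eq h1)
    have hn0 : (lengthAt R M 𝔭).toNat ≠ 0 := by
      intro h0
      rcases (ENat.toNat_eq_zero).mp h0 with h | h
      · exact hne h
      · exact hfinlen h
    rw [Function.mem_mulSupport]
    intro hF1
    have hle : 𝔭.asIdeal ^ (lengthAt R M 𝔭).toNat ≤ 𝔭.asIdeal := Ideal.pow_le_self hn0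
    rw [hF1, Ideal.one_eq_top, top_le_iff] at hle
    exact 𝔭.isPrime.ne_top hle
  · rw [hchar, ← Ideal.prod_span_singleton]
    refine Finset.prod_congr rfl fun 𝔭 h𝔭 => ?_
    simp only [F]
    rw [hπeq 𝔭 h𝔭, Ideal.span_singleton_pow]

/-- **§3.1.6: `Fitt_A(X) ⊆ Char_A(X)`** for a finite module over a Noetherian unique factorization
domain ("the characteristic ideal is the smallest divisorial ideal containing the Fitting ideal";
no torsion hypothesis: for `X` not torsion `Fitt_A(X) = 0`). Torsion case: `Char(X) =
(∏ π_𝔭^{ℓ_𝔭})` and each `π_𝔭^{ℓ_𝔭}` divides every element of `Fitt_A(X)`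
(`pow_toNat_lengthAt_dvd_of_mem_fittingIdeal_zero`), the `π_𝔭` being pairwise non-associated.
[cite: SkinnerUrban2014, §3.1.6 (p. 20) and Cor. 3.2.9 (proof, p. 24)] -/
theorem fittingIdeal_zero_le_charIdeal : Module.fittingIdeal R M 0 ≤ charIdeal R M := by
  classical
  by_cases hM : Module.IsTorsion R M
  swap
  · have hF : Module.fittingIdeal R M 0 = ⊥ :=
      le_bot_iff.mp ((Module.fittingIdeal_zero_le_annihilator).trans
        (Module.annihilator_eq_bot_of_not_isTorsion hM).le)
    rw [hF]; exact bot_le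
  obtain ⟨t, π, ht, -, -, hchar⟩ := exists_charIdeal_eq_span_prod (M := M) hM
  intro x hx
  rw [hchar, Ideal.mem_span_singleton]
  refine Finset.prod_dvd_of_isRelPrime ?_ ?_
  · intro 𝔭 h𝔭 𝔮 h𝔮 hne
    refine isRelPrime_pow_of_not_associated (ht 𝔭 h𝔭).2.1 (ht 𝔮 h𝔮).2.1 (fun hass => hne ?_) _ _
    exact PrimeSpectrum.ext
      ((ht 𝔭 h𝔭).2.2.trans ((Ideal.span_singleton_eq_span_singleton.mpr hass).trans
        (ht 𝔮 h𝔮).2.2.symm))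
  · intro 𝔭 h𝔭
    exact pow_toNat_lengthAt_dvd_of_mem_fittingIdeal_zero hM (ht 𝔭 h𝔭).2.1 𝔭 (ht 𝔭 h𝔭).2.2 hx

/-- **§3.1.6 / proof of Cor. 3.2.9 (ii): a principal ideal containing `Fitt_A(X)` contains
`Char_A(X)`** ("the characteristic ideal is the smallest divisorial ideal containing the Fitting
ideal (and … principal ideals are divisorial)"), for a finite torsion module `X` over a Noetherian
UFD: `g ∣ ∏ π_𝔭^{ℓ_𝔭}` because every prime power `ρ^k ∣ g` has `k ≤ ℓ_{(ρ)}(X)`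
(`natCast_le_lengthAt_of_fittingIdeal_zero_le_of_pow_dvd`) and `(ρ)` is then one of the `𝔭`.
[cite: SkinnerUrban2014, §3.1.6 (p. 20) and Cor. 3.2.9 (proof, p. 24)] -/
theorem charIdeal_le_span_singleton_of_fittingIdeal_zero_le (hM : Module.IsTorsion R M) {g : R}
    (hFg : Module.fittingIdeal R M 0 ≤ Ideal.span {g}) : charIdeal R M ≤ Ideal.span {g} := by
  classical
  have hg0 : g ≠ 0 := by
    rintro rfl
    refine fittingIdeal_zero_ne_bot_of_isTorsion (M := M) hM (le_bot_iff.mp ?_)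
    simpa using hFg
  obtain ⟨t, π, ht, hfinite, hsupp, hchar⟩ := exists_charIdeal_eq_span_prod (M := M) hM
  rw [hchar, Ideal.span_singleton_le_span_singleton]
  refine (UniqueFactorizationMonoid.dvd_iff_emultiplicity_le hg0).mpr fun ρ hρ => ?_
  rw [emultiplicity_le_emultiplicity_iff]
  intro k hk
  rcases Nat.eq_zero_or_pos k with rfl | hkpos
  · rw [pow_zero]; exact one_dvd _
  -- the height-one prime `(ρ)`
  haveI := (Ideal.span_singleton_prime hρ.ne_zero).mpr hρ
  let 𝔭₀ : PrimeSpectrum R := ⟨Ideal.span {ρ}, inferInstance⟩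
  have h1 : 𝔭₀.asIdeal.height = 1 := height_span_singleton_eq_one_of_prime hρ
  have hkle : (k : ℕ∞) ≤ lengthAt R M 𝔭₀ :=
    natCast_le_lengthAt_of_fittingIdeal_zero_le_of_pow_dvd hM hρ hk hFg 𝔭₀ rfl
  obtain ⟨n, hn⟩ := ENat.ne_top_iff_exists.mp (hfinite 𝔭₀ h1)
  rw [← hn, Nat.cast_le] at hkle
  have hne : lengthAt R M 𝔭₀ ≠ 0 := by
    rw [← hn]
    exact_mod_cast (by omega : n ≠ 0)
  have h𝔭₀t : 𝔭₀ ∈ t := hsupp 𝔭₀ h1 hne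
  have hass : Associated ρ (π 𝔭₀) :=
    Ideal.span_singleton_eq_span_singleton.mp (ht 𝔭₀ h𝔭₀t).2.2
  calc ρ ^ k ∣ π 𝔭₀ ^ k := (hass.pow_pow).dvd
    _ ∣ π 𝔭₀ ^ (lengthAt R M 𝔭₀).toNat :=
        pow_dvd_pow _ (by rw [← hn, ENat.toNat_coe]; exact hkle)
    _ ∣ ∏ 𝔭 ∈ t, π 𝔭 ^ (lengthAt R M 𝔭).toNat :=
        Finset.dvd_prod_of_mem (fun 𝔭 => π 𝔭 ^ (lengthAt R M 𝔭).toNat) h𝔭₀t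

/-- **§3.1.6 for principal ideals: `Char_A(X)` is the smallest principal ideal containing
`Fitt_A(X)`** — over a Noetherian UFD and for a finite torsion module `X`, a principal ideal
contains `Char_A(X)` iff it contains `Fitt_A(X)` (in the paper: "the characteristic ideal is the
smallest divisorial ideal containing the Fitting ideal", and in a UFD the divisorial ideals are the
principal ones). [cite: SkinnerUrban2014, §3.1.6 (p. 20) and Cor. 3.2.9 (proof, p. 24)] -/
theorem charIdeal_le_span_singleton_iff (hM : Module.IsTorsion R M) {g : R} :
    charIdeal R M ≤ Ideal.span {g} ↔ Module.fittingIdeal R M 0 ≤ Ideal.span {g} :=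
  ⟨fun h => fittingIdeal_zero_le_charIdeal.trans h,
    charIdeal_le_span_singleton_of_fittingIdeal_zero_le hM⟩

end UFD

/-! ### Corollary 3.2.9 -/

section BaseChange

/-- **Cor. 3.2.9 (i) / §3.1.6: "`Fitt_{A/𝔞}(X/𝔞X) = Fitt_A(X) mod 𝔞`"** — Fitting ideals commute
with reduction modulo an ideal (the tree's `Module.fittingIdeal_baseChange`, Stacks 07ZA (3), at
`B = A/𝔞`; `X/𝔞X = (A/𝔞) ⊗_A X`). [cite: SkinnerUrban2014, §3.1.6 (p. 19) and Cor. 3.2.9 (i) (p. 24)]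
[cite: StacksProject, Tag 07ZA] -/
theorem fittingIdeal_quotient_baseChange (𝔞 : Ideal R) (M : Type v) [AddCommGroup M]
    [Module R M] [Module.Finite R M] (k : ℕ) :
    Module.fittingIdeal (R ⧸ 𝔞) ((R ⧸ 𝔞) ⊗[R] M) k =
      (Module.fittingIdeal R M k).map (Ideal.Quotient.mk 𝔞) := by
  rw [Module.fittingIdeal_baseChange, Ideal.Quotient.algebraMap_eq]

variable [IsNoetherianRing R] [IsDomain R] [UniqueFactorizationMonoid R]
  {M : Type v} [AddCommGroup M] [Module R M] [Module.Finite R M]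

/-- **Cor. 3.2.9 (ii), base-change form**: let `A` be a Noetherian UFD, `X` a finite `A`-module
and `(f) ⊇ Char_A(X)` a principal ideal; for any Noetherian UFD `A`-algebra `B` such that
`X ⊗_A B` is `B`-torsion, `(f · 1_B) ⊇ Char_B(X ⊗_A B)`. Printed proof, verbatim in the kernel:
`Fitt_A(X) ⊆ Char_A(X) ⊆ (f)` (`fittingIdeal_zero_le_charIdeal`), `Fitt_B(X ⊗ B) = Fitt_A(X) B ⊆
(f) B` (Stacks 07ZA (3)), and `Char_B` is the smallest principal ideal containing `Fitt_B`
(`charIdeal_le_span_singleton_of_fittingIdeal_zero_le`).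
[cite: SkinnerUrban2014, Cor. 3.2.9 (ii) (p. 24)] -/
theorem charIdeal_baseChange_le_span_singleton (S : Type w) [CommRing S] [Algebra R S]
    [IsNoetherianRing S] [IsDomain S] [UniqueFactorizationMonoid S]
    {f : R} (hf : charIdeal R M ≤ Ideal.span {f}) (hT : Module.IsTorsion S (S ⊗[R] M)) :
    charIdeal S (S ⊗[R] M) ≤ Ideal.span {algebraMap R S f} := by
  refine charIdeal_le_span_singleton_of_fittingIdeal_zero_le hT ?_
  rw [Module.fittingIdeal_baseChange]
  refine (Ideal.map_mono ((fittingIdeal_zero_le_charIdeal (M := M)).trans hf)).trans ?_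
  rw [Ideal.map_span, Set.image_singleton]

/-- **Cor. 3.2.9 (ii), as printed** ("if `A` and `A/𝔞` are noetherian normal domains then
`(f) mod 𝔞` divides `Ch_{A/𝔞}(T/𝔞)` for any principal ideal `(f) ⊇ Ch_A`"), in the UFD case:
`Ch_{A/𝔞}((A/𝔞) ⊗_A X) ⊆ (f mod 𝔞)`. The torsion hypothesis on `X/𝔞X` is the tree's reading of
the printed convention `ℓ_Q = ∞` (module docstring).
[cite: SkinnerUrban2014, Cor. 3.2.9 (ii) (p. 24)] -/
theorem corollary329_charIdeal_quotient_le_span_singleton (𝔞 : Ideal R) [IsDomain (R ⧸ 𝔞)]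
    [UniqueFactorizationMonoid (R ⧸ 𝔞)] {f : R} (hf : charIdeal R M ≤ Ideal.span {f})
    (hT : Module.IsTorsion (R ⧸ 𝔞) ((R ⧸ 𝔞) ⊗[R] M)) :
    charIdeal (R ⧸ 𝔞) ((R ⧸ 𝔞) ⊗[R] M) ≤ Ideal.span {Ideal.Quotient.mk 𝔞 f} := by
  have h := charIdeal_baseChange_le_span_singleton (M := M) (R ⧸ 𝔞) hf hT
  rwa [Ideal.Quotient.algebraMap_eq] at h

/-- **Cor. 3.2.9 (ii), "in particular, if `A` is a unique factorization domain then `Ch_A(T) mod 𝔞`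
divides `Ch_{A/𝔞}(T/𝔞)`"**: `Ch_{A/𝔞}((A/𝔞) ⊗_A X) ⊆ Ch_A(X)·(A/𝔞)` whenever `Ch_A(X)` is
principal (automatic over a UFD; for `Λ = ℤ_p⟦T⟧` it is the tree theorem
`charIdeal_isPrincipal_holds`, see `corollary329_iwasawaAlgebra`).
[cite: SkinnerUrban2014, Cor. 3.2.9 (ii) (p. 24)] -/
theorem corollary329_charIdeal_quotient_le_map_charIdeal (𝔞 : Ideal R) [IsDomain (R ⧸ 𝔞)]
    [UniqueFactorizationMonoid (R ⧸ 𝔞)] (hprinc : (charIdeal R M).IsPrincipal)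
    (hT : Module.IsTorsion (R ⧸ 𝔞) ((R ⧸ 𝔞) ⊗[R] M)) :
    charIdeal (R ⧸ 𝔞) ((R ⧸ 𝔞) ⊗[R] M) ≤ (charIdeal R M).map (Ideal.Quotient.mk 𝔞) := by
  obtain ⟨c, hc⟩ := hprinc
  have hc' : charIdeal R M = Ideal.span {c} := by rw [hc, Ideal.submodule_span_eq]
  rw [hc', Ideal.map_span, Set.image_singleton]
  exact corollary329_charIdeal_quotient_le_span_singleton 𝔞 hc'.le hT

end BaseChange

section Iwasawa

variable (p : ℕ) [Fact p.Prime]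

/-- **Cor. 3.2.9 (ii) for the Iwasawa algebra `Λ = ℤ_p⟦T⟧`** (a Noetherian UFD in which
`Char_Λ(X)` is principal, tree theorem `charIdeal_isPrincipal_holds`): for a finitely generated
`Λ`-module `X` and an ideal `𝔞` with `Λ/𝔞` a UFD (e.g. `𝔞 = (T)`, `Λ/𝔞 ≅ ℤ_p`; `𝔞 = (p)`,
`Λ/𝔞 ≅ 𝔽_p⟦T⟧`) such that `X/𝔞X` is `Λ/𝔞`-torsion, `Ch_{Λ/𝔞}(X/𝔞X) ⊆ Ch_Λ(X) mod 𝔞` — the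
specialisation step of every descent of a main conjecture along `Λ → Λ/𝔞` (S–U Prop. 3.2.11,
proof of Thm. 3.6.4 p. 43). [cite: SkinnerUrban2014, Cor. 3.2.9 (ii) (p. 24) and Prop. 3.2.11] -/
theorem corollary329_iwasawaAlgebra (𝔞 : Ideal (IwasawaAlgebra p))
    [IsDomain (IwasawaAlgebra p ⧸ 𝔞)] [UniqueFactorizationMonoid (IwasawaAlgebra p ⧸ 𝔞)]
    (M : Type v) [AddCommGroup M] [Module (IwasawaAlgebra p) M]
    [Module.Finite (IwasawaAlgebra p) M]
    (hT : Module.IsTorsion (IwasawaAlgebra p ⧸ 𝔞)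
      ((IwasawaAlgebra p ⧸ 𝔞) ⊗[IwasawaAlgebra p] M)) :
    charIdeal (IwasawaAlgebra p ⧸ 𝔞) ((IwasawaAlgebra p ⧸ 𝔞) ⊗[IwasawaAlgebra p] M) ≤
      (charIdeal (IwasawaAlgebra p) M).map (Ideal.Quotient.mk 𝔞) :=
  corollary329_charIdeal_quotient_le_map_charIdeal 𝔞 (charIdeal_isPrincipal_holds p M) hT

end Iwasawa

/-! ### The two specialisations of `Λ = ℤ_p⟦T⟧` used by Skinner–Urban and Greenberg:
`T ↦ 0` (`Λ/(T) ≅ ℤ_p`, the cyclotomic variable; S–U Prop. 3.2.13 / Greenberg's control theorem)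
and reduction modulo `p` (`Λ/(p) ≅ 𝔽_p⟦T⟧`, the `μ`-part) — appended 2026-08-21 (lit-su gen 6)

Both quotients are principal ideal domains, so `corollary329_iwasawaAlgebra` applies to them with
no instance left to the user. Stated as theorems (`IsDomain`, `IsPrincipalIdealRing` are
propositions), to be introduced with `haveI` where needed. -/

section IwasawaSpecializations

variable (p : ℕ) [Fact p.Prime]

open IwasawaAlgebra

/-- `Λ/(T)` is a domain: the constant term identifies it with `ℤ_p` (tree
`IwasawaAlgebra.quotientSpanXEquiv`; Washington §13.2, the prime `(T)` of `Λ`).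
[cite: Washington1997, §13.2] -/
theorem isDomain_quotient_span_X :
    IsDomain (IwasawaAlgebra p ⧸ Ideal.span {(PowerSeries.X : IwasawaAlgebra p)}) :=
  (quotientSpanXEquiv p).toMulEquiv.isDomain

/-- `Λ/(T) ≅ ℤ_p` is a principal ideal ring (Washington §13.2). [cite: Washington1997, §13.2] -/
theorem isPrincipalIdealRing_quotient_span_X :
    IsPrincipalIdealRing (IwasawaAlgebra p ⧸ Ideal.span {(PowerSeries.X : IwasawaAlgebra p)}) :=
  IsPrincipalIdealRing.of_surjective (quotientSpanXEquiv p).symm.toRingHom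
    (quotientSpanXEquiv p).symm.surjective

/-- `Λ/(p)` is a domain: `(p) = ker (ℤ_p⟦T⟧ → 𝔽_p⟦T⟧)` is prime (tree theorem
`isPrime_augIdealP_holds`; Washington §13.1: `Λ/pΛ ≅ 𝔽_p⟦T⟧`). [cite: Washington1997, §13.1] -/
theorem isDomain_quotient_augIdealP : IsDomain (IwasawaAlgebra p ⧸ augIdealP p) :=
  haveI : (augIdealP p).IsPrime := isPrime_augIdealP_holds p
  Ideal.Quotient.isDomain _

/-- `Λ/(p) ≅ 𝔽_p⟦T⟧` is a principal ideal ring (reduction of coefficients modulo `p` is onto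
`𝔽_p⟦T⟧`, a discrete valuation ring, with kernel `(p)` — tree `map_residue_eq_zero_iff`;
Washington §13.1). [cite: Washington1997, §13.1] -/
theorem isPrincipalIdealRing_quotient_augIdealP :
    IsPrincipalIdealRing (IwasawaAlgebra p ⧸ augIdealP p) := by
  set φ : IwasawaAlgebra p →+* PowerSeries (IsLocalRing.ResidueField ℤ_[p]) :=
    PowerSeries.map (IsLocalRing.residue ℤ_[p]) with hφ_def
  have hφ : Function.Surjective φ :=
    PowerSeries.map_surjective _ IsLocalRing.residue_surjective
  have hker : RingHom.ker φ = augIdealP p := by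
    ext f
    rw [RingHom.mem_ker, hφ_def, map_residue_eq_zero_iff]
  let e : (IwasawaAlgebra p ⧸ augIdealP p) ≃+* PowerSeries (IsLocalRing.ResidueField ℤ_[p]) :=
    (Ideal.quotEquivOfEq hker.symm).trans (RingHom.quotientKerEquivOfSurjective hφ)
  exact IsPrincipalIdealRing.of_surjective e.symm.toRingHom e.symm.surjective

variable (M : Type v) [AddCommGroup M] [Module (IwasawaAlgebra p) M]
  [Module.Finite (IwasawaAlgebra p) M]

/-- **Cor. 3.2.9 (ii) at the cyclotomic specialisation `T ↦ 0`** (`Λ → Λ/(T) = ℤ_p`; the base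
change of S–U Prop. 3.2.13 and of Greenberg's control theorem): for a finitely generated
`Λ`-module `X` with `X/TX` a torsion `Λ/(T)`-module (i.e. finite),
`Ch_{Λ/(T)}(X/TX) ⊆ Ch_Λ(X) mod (T)` — in classical terms, `f_X(0)` divides `#(X/TX)` up to a
`p`-adic unit. [cite: SkinnerUrban2014, Cor. 3.2.9 (ii) (p. 24) and Prop. 3.2.13 (p. 25)] -/
theorem corollary329_iwasawaAlgebra_span_X
    (hT : Module.IsTorsion (IwasawaAlgebra p ⧸ Ideal.span {(PowerSeries.X : IwasawaAlgebra p)})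
      ((IwasawaAlgebra p ⧸ Ideal.span {(PowerSeries.X : IwasawaAlgebra p)})
        ⊗[IwasawaAlgebra p] M)) :
    charIdeal (IwasawaAlgebra p ⧸ Ideal.span {(PowerSeries.X : IwasawaAlgebra p)})
        ((IwasawaAlgebra p ⧸ Ideal.span {(PowerSeries.X : IwasawaAlgebra p)})
          ⊗[IwasawaAlgebra p] M) ≤
      (charIdeal (IwasawaAlgebra p) M).map
        (Ideal.Quotient.mk (Ideal.span {(PowerSeries.X : IwasawaAlgebra p)})) := by
  haveI := isDomain_quotient_span_X p
  haveI := isPrincipalIdealRing_quotient_span_X p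
  exact corollary329_iwasawaAlgebra p _ M hT

/-- **Cor. 3.2.9 (ii) at the reduction modulo `p`** (`Λ → Λ/(p) = 𝔽_p⟦T⟧`; the `μ`-part): for a
finitely generated `Λ`-module `X` with `X/pX` a torsion `𝔽_p⟦T⟧`-module,
`Ch_{Λ/(p)}(X/pX) ⊆ Ch_Λ(X) mod (p)`. [cite: SkinnerUrban2014, Cor. 3.2.9 (ii) (p. 24)] -/
theorem corollary329_iwasawaAlgebra_augIdealP
    (hT : Module.IsTorsion (IwasawaAlgebra p ⧸ augIdealP p)
      ((IwasawaAlgebra p ⧸ augIdealP p) ⊗[IwasawaAlgebra p] M)) :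
    charIdeal (IwasawaAlgebra p ⧸ augIdealP p)
        ((IwasawaAlgebra p ⧸ augIdealP p) ⊗[IwasawaAlgebra p] M) ≤
      (charIdeal (IwasawaAlgebra p) M).map (Ideal.Quotient.mk (augIdealP p)) := by
  haveI := isDomain_quotient_augIdealP p
  haveI := isPrincipalIdealRing_quotient_augIdealP p
  exact corollary329_iwasawaAlgebra p _ M hT

end IwasawaSpecializations

/-! ### Appended (2026-08-26, typing layer `bsd-littype` seat 10): §3.1.6, converse bookkeeping —
over a Noetherian UFD the characteristic ideal of a finite torsion module DETERMINES its height-one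
local lengths (`Char(X) ⊆ Char(Y) ⟹ ℓ_𝔭(Y) ≤ ℓ_𝔭(X)`; `Char(X) = Char(Y) ⟹ ℓ_𝔭(X) = ℓ_𝔭(Y)`) -/

section Determines

variable {R : Type u} [CommRing R] [IsNoetherianRing R] [IsDomain R] [UniqueFactorizationMonoid R]
  {M : Type v} [AddCommGroup M] [Module R M] [Module.Finite R M]
  {N : Type w} [AddCommGroup N] [Module R N] [Module.Finite R N]

/-- **`Char_A(X) ⊆ Char_A(Y) ⟹ ℓ_𝔭(Y) ≤ ℓ_𝔭(X)` at every height-one prime `𝔭`**, for finite torsion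
modules `X`, `Y` over a Noetherian UFD `A` — a consequence of §3.1.6 ("the characteristic ideal is
the smallest divisorial ideal containing the Fitting ideal"): write `Char(Y) = (∏ π_𝔮^{ℓ_𝔮(Y)})`
(`exists_charIdeal_eq_span_prod`), so `Char(X) ⊆ Char(Y) ⊆ (π_𝔭^{ℓ_𝔭(Y)})`, hence
`Fitt_A(X) ⊆ (π_𝔭^{ℓ_𝔭(Y)})` (`charIdeal_le_span_singleton_iff`) and `ℓ_𝔭(Y) ≤ ℓ_𝔭(X)`
(`natCast_le_lengthAt_of_fittingIdeal_zero_le_of_pow_dvd`).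
[cite: SkinnerUrban2014, §3.1.6 (p. 20)] [cite: Washington1997, §13.2] -/
theorem lengthAt_le_of_charIdeal_le (hM : Module.IsTorsion R M) (hN : Module.IsTorsion R N)
    (h : charIdeal R M ≤ charIdeal R N) (𝔭 : PrimeSpectrum R) (h𝔭 : 𝔭.asIdeal.height = 1) :
    lengthAt R N 𝔭 ≤ lengthAt R M 𝔭 := by
  classical
  obtain ⟨t, π, ht, hfin, hsupp, hchar⟩ := exists_charIdeal_eq_span_prod (M := N) hN
  by_cases h0 : lengthAt R N 𝔭 = 0
  · rw [h0]; exact bot_le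
  have h𝔭t : 𝔭 ∈ t := hsupp 𝔭 h𝔭 h0
  obtain ⟨-, hρ, hρeq⟩ := ht 𝔭 h𝔭t
  obtain ⟨n, hn⟩ := ENat.ne_top_iff_exists.mp (hfin 𝔭 h𝔭)
  have hton : (lengthAt R N 𝔭).toNat = n := by rw [← hn, ENat.toNat_coe]
  have hle : charIdeal R N ≤ Ideal.span {π 𝔭 ^ n} := by
    rw [hchar, Ideal.span_singleton_le_span_singleton, ← hton]
    exact Finset.dvd_prod_of_mem (fun 𝔮 => π 𝔮 ^ (lengthAt R N 𝔮).toNat) h𝔭t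
  have hF : Module.fittingIdeal R M 0 ≤ Ideal.span {π 𝔭 ^ n} :=
    (charIdeal_le_span_singleton_iff hM).mp (h.trans hle)
  rw [← hn]
  exact natCast_le_lengthAt_of_fittingIdeal_zero_le_of_pow_dvd hM hρ (dvd_refl _) hF 𝔭 hρeq

/-- **`Char_A(X) = Char_A(Y) ⟹ ℓ_𝔭(X) = ℓ_𝔭(Y)` at every height-one prime `𝔭`** (finite torsion
modules over a Noetherian UFD): the characteristic ideal and the family of height-one local lengths
determine each other (`Module.charIdeal_eq_of_lengthAt_eq` is the converse).  This is what lets a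
main conjecture typed as an equality of characteristic IDEALS be read prime by prime.
[cite: SkinnerUrban2014, §3.1.6 (p. 20)] [cite: Washington1997, §13.2] -/
theorem lengthAt_eq_of_charIdeal_eq (hM : Module.IsTorsion R M) (hN : Module.IsTorsion R N)
    (h : charIdeal R M = charIdeal R N) (𝔭 : PrimeSpectrum R) (h𝔭 : 𝔭.asIdeal.height = 1) :
    lengthAt R M 𝔭 = lengthAt R N 𝔭 :=
  le_antisymm (lengthAt_le_of_charIdeal_le hN hM h.ge 𝔭 h𝔭)
    (lengthAt_le_of_charIdeal_le hM hN h.le 𝔭 h𝔭)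

end Determines

end Literature.NumberTheory.EllipticCurves.SkinnerUrban2014

end
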